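import Summits.HodgeConjecture.CorCM.Census.CyclicCharacterFibreLaw

/-!
# Cyclic characters, III: a central involution OUTSIDE the commutator subgroup has a cyclic character — `d₂(G/𝒦) ≤ 1` unless `c ∈ [G, G]`

COR-CM (cell `pub-hodgecm2`), count-neutral kernel combinatorics by the binder seat b09 (gen 41; lane CYCLIC-CHARACTER FIBRE LAW, part V — the intrinsic
form of the class of parts I–II), on top of `Census/CyclicCharacterFibre{,Law}.lean`, lit-andre-3ʼs `𝒦` / `d₂` (`Census/TypeStabiliser*`) and Mathlibʼs
structure theorem of finite abelian groups (`CommGroup.equiv_prod_multiplicative_zmod_of_finite`) applied to the abelianisation, all BY NAME.  Theorems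
only (no definition, no `decide`, no certificate, no named fact, no `sorry`).
HONEST FRAMING: `HC_CM` is NOT proved, here or anywhere in the tree; nothing here is a period or a headline.

* §1 **A central involution `c ∉ [G, G]` has a CYCLIC CHARACTER** (`exists_cyclicCharacter_of_notMem_commutator`): an additive, onto `w : G → ℤ/2ᵏ` (`k ≥ 1`)
  with `w c ≠ 0` — a coordinate of `c̄ ≠ 1` in `G^{ab} ≅ Π ℤ/nᵢ` followed by the projection `ℤ/nᵢ ↠ ℤ/2ᵏ`, `2ᵏ ∥ nᵢ`.
* §2 hence THE DICHOTOMY: `k = 1` — `c` is COMPLEMENTED (`ker w`; gen 31ʼs direct-factor law, `d₂(G/𝒦) = 0`); `k ≥ 2` — parts I–II (`d₂(G/𝒦) ≤ 1`,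
  `φ₂ + 2 = β + d`).  So **`d₂(G/𝒦) ≤ 1` for every central involution outside the commutator subgroup** (`indexTwoRank_stabGen_le_one_of_notMem_commutator`),
  i.e. **`d₂(G/𝒦) ≥ 2 ⇒ c ∈ [G, G]`** (`mem_commutator_of_two_le_indexTwoRank`): lit-andre-3ʼs «divided parities» beyond one (`Q₈ × B`, `Q_{4n}` with `n` even,
  the unbounded `d₂` of `Census/TypeStabiliserUnbounded.lean`) can only occur when complex conjugation is a product of commutators of the Galois group.
* §3 in the fibre currency: **`β − 2 ≤ φ₂ ≤ β` whenever `c ∉ [G, G]`** (`card_block_le_fibreTwo_add_two_of_notMem_commutator`,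
  `fibreTwo_le_card_block_of_notMem_commutator`), against `φ₂ = β − 1 − [|G|/2 even] + d₂` unbounded above in general.

## References
* [Pohlmann1968] H. Pohlmann, Algebraic cycles on abelian varieties of complex multiplication type, Ann. of Math. 88 (1968), Thm 1.
* [Milne1999] J. S. Milne, Lefschetz motives and the Tate conjecture, Compositio Math. 117 (1999), Prop. 2.1, p. 54.
-/

namespace Summit.HodgeConjecture.CorCM.Census.CyclicCharacter

open Summit.HodgeConjecture.CorCM.Prior.AllgGroup.RfwfAllgGroup
open Summit.HodgeConjecture.CorCM.Census.BlockParity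
open Summit.HodgeConjecture.CorCM.Census.Coinvariant
open Summit.HodgeConjecture.CorCM.Census.TypeStabiliser
open Summit.HodgeConjecture.CorCM.Census.IndexTwo

section Commutator

variable {G : Type*} [Group G] {c : G}

/-! ## §1 A central involution outside the commutator subgroup has a cyclic character -/

/-- **Arithmetic core**: in `ℤ/(2ᵏ·m)` with `m` odd, an element `x ≠ 0` with `x + x = 0` is NOT killed by the projection to `ℤ/2ᵏ` (its value is
`2ᵏ⁻¹·m`, an odd multiple of `2ᵏ⁻¹`). [folklore] -/
theorem cast_ne_zero_of_add_self_eq_zero {N k m : ℕ} (hdvd : 2 ^ k ∣ N) (hN : N = 2 ^ k * m) (hm : Odd m) {x : ZMod N} (hx0 : x ≠ 0)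
    (hxx : x + x = 0) : (ZMod.castHom hdvd (ZMod (2 ^ k))) x ≠ 0 := by
  subst hN
  haveI : NeZero (2 ^ k * m) := ⟨Nat.mul_ne_zero (pow_ne_zero _ two_ne_zero) (by rintro rfl; exact (Nat.not_odd_zero hm).elim)⟩
  haveI : NeZero (2 ^ k) := ⟨pow_ne_zero _ two_ne_zero⟩
  intro h
  rw [ZMod.castHom_apply, ZMod.cast_eq_val, ZMod.natCast_eq_zero_iff] at h
  -- `2^k ∣ x.val`, `2^k m ∣ 2 x.val`, hence `x.val = 0`
  obtain ⟨q, hq⟩ := h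
  have hval : (x + x).val = 0 := by rw [hxx, ZMod.val_zero]
  rw [ZMod.val_add] at hval
  have hdvd : 2 ^ k * m ∣ x.val + x.val := Nat.dvd_of_mod_eq_zero hval
  rw [hq, ← two_mul, ← mul_assoc, mul_comm 2 (2 ^ k), mul_assoc] at hdvd
  have hm2 : m ∣ 2 * q := Nat.dvd_of_mul_dvd_mul_left (pow_pos two_pos k) hdvd
  have hmq : m ∣ q := Nat.Coprime.dvd_of_dvd_mul_left (Nat.coprime_two_left.mpr hm).symm hm2
  obtain ⟨q', rfl⟩ := hmq
  have hlt := ZMod.val_lt x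
  rw [hq] at hlt
  have hq' : q' = 0 := by
    by_contra hne
    have : 2 ^ k * m * 1 ≤ 2 ^ k * (m * q') := by
      rw [mul_one, ← mul_assoc]
      exact Nat.le_mul_of_pos_right _ (Nat.pos_of_ne_zero hne)
    omega
  apply hx0
  rw [← ZMod.natCast_zmod_val x, hq, hq', mul_zero, mul_zero, Nat.cast_zero]

/-- **A central involution outside the commutator subgroup has a cyclic character**: if `c² = 1` and `c ∉ [G, G]` (finite `G`) there are `k ≥ 1` and an
additive, onto `w : G → ℤ/2ᵏ` with `w c ≠ 0`. [folklore] -/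
theorem exists_cyclicCharacter_of_notMem_commutator [Finite G] (hc2 : c * c = 1) (hc : c ∉ commutator G) :
    ∃ k : ℕ, 1 ≤ k ∧ ∃ w : G → ZMod (2 ^ k), (∀ P Q : G, w (P * Q) = w P + w Q) ∧ (∃ g : G, w g = 1) ∧ w c ≠ 0 := by
  classical
  -- the abelianisation and its cyclic decomposition
  have hπc : Abelianization.of c ≠ (1 : Abelianization G) := by
    intro h
    apply hc
    rw [← Abelianization.ker_of G, MonoidHom.mem_ker]
    exact h
  obtain ⟨ι, _, n, hn, ⟨e⟩⟩ := CommGroup.equiv_prod_multiplicative_zmod_of_finite (Abelianization G)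
  obtain ⟨i, hi⟩ : ∃ i : ι, e (Abelianization.of c) i ≠ 1 := by
    by_contra h
    push Not at h
    exact hπc (e.injective ((funext h).trans (_root_.map_one e).symm))
  -- the coordinate `x` of `c̄` in `ℤ/nᵢ`: non-zero, `x + x = 0`
  set x : ZMod (n i) := Multiplicative.toAdd (e (Abelianization.of c) i) with hx
  have hx0 : x ≠ 0 := fun h => hi (by rw [← ofAdd_toAdd (e (Abelianization.of c) i), ← hx, h, ofAdd_zero])
  have hxx : x + x = 0 := by
    rw [hx, ← toAdd_mul, ← Pi.mul_apply, ← map_mul, ← map_mul, hc2, _root_.map_one, _root_.map_one, Pi.one_apply, toAdd_one]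
  -- `nᵢ = 2ᵏ m`, `m` odd, `k ≥ 1`
  have hni : n i ≠ 0 := by have := hn i; omega
  obtain ⟨k, m, hm, hnm⟩ := Nat.exists_eq_two_pow_mul_odd hni
  have hk : 1 ≤ k := by
    by_contra hk0
    have hk0' : k = 0 := by omega
    rw [hk0', pow_zero, one_mul] at hnm
    -- `nᵢ` odd: `2` is a unit in `ℤ/nᵢ`, so `x + x = 0` forces `x = 0`
    have hu : IsUnit ((2 : ℕ) : ZMod (n i)) := by
      rw [ZMod.isUnit_iff_coprime, hnm]
      exact Nat.coprime_two_left.mpr hm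
    apply hx0
    have h2x : ((2 : ℕ) : ZMod (n i)) * x = 0 := by rw [Nat.cast_ofNat, two_mul, hxx]
    exact (hu.mul_right_eq_zero).mp h2x
  -- the character: coordinate `i`, then the projection `ℤ/nᵢ ↠ ℤ/2ᵏ`
  have hdvd : 2 ^ k ∣ n i := Dvd.intro m hnm.symm
  set ψ : ZMod (n i) →+* ZMod (2 ^ k) := ZMod.castHom hdvd (ZMod (2 ^ k)) with hψ
  refine ⟨k, hk, fun g => ψ (Multiplicative.toAdd (e (Abelianization.of g) i)), fun P Q => ?_, ?_, ?_⟩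
  · show ψ (Multiplicative.toAdd (e (Abelianization.of (P * Q)) i)) =
      ψ (Multiplicative.toAdd (e (Abelianization.of P) i)) + ψ (Multiplicative.toAdd (e (Abelianization.of Q) i))
    rw [map_mul, map_mul, Pi.mul_apply, toAdd_mul, map_add]
  · -- onto: hit `1` with a preimage of the `i`-th basis vector
    haveI : NeZero (n i) := ⟨hni⟩
    obtain ⟨g, hg⟩ := Quot.exists_rep (e.symm (Pi.mulSingle i (Multiplicative.ofAdd (1 : ZMod (n i)))))
    rw [Abelianization.mk_eq_of] at hg
    refine ⟨g, ?_⟩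
    show ψ (Multiplicative.toAdd (e (Abelianization.of g) i)) = 1
    rw [hg, MulEquiv.apply_symm_apply, Pi.mulSingle_eq_same, toAdd_ofAdd, _root_.map_one]
  · show ψ x ≠ 0
    exact cast_ne_zero_of_add_self_eq_zero hdvd hnm hm hx0 hxx

/-! ## §2 The dichotomy: complemented (`k = 1`) or a cyclic character of level `≥ 4` (`k ≥ 2`) -/

/-- The kernel of an additive map `w : G → ℤ/2ᵏ` as a subgroup (membership `w g = 0`). [folklore] -/
theorem exists_ker {k : ℕ} {w : G → ZMod (2 ^ k)} (hw : ∀ P Q : G, w (P * Q) = w P + w Q) :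
    ∃ K : Subgroup G, ∀ g : G, g ∈ K ↔ w g = 0 :=
  ⟨{ carrier := {g | w g = 0}
     mul_mem' := fun {a b} ha hb => by
       simp only [Set.mem_setOf_eq] at ha hb ⊢
       rw [hw, ha, hb, add_zero]
     one_mem' := map_one hw
     inv_mem' := fun {a} ha => by
       simp only [Set.mem_setOf_eq] at ha ⊢
       rw [map_inv hw, ha, neg_zero] }, fun _ => Iff.rfl⟩

/-- **Level `k = 1`: the kernel of `w` is a COMPLEMENT of `c`** (`x ∈ K ↔ c·x ∉ K`). [folklore] -/
theorem isComplement_ker_of_level_one {w : G → ZMod (2 ^ 1)} (hw : ∀ P Q : G, w (P * Q) = w P + w Q) (hwc : w c ≠ 0)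
    {K : Subgroup G} (hK : ∀ g : G, g ∈ K ↔ w g = 0) : ∀ x : G, x ∈ K ↔ c * x ∉ K := by
  have h2 : ∀ y : ZMod (2 ^ 1), y = 0 ∨ y = 1 := by decide
  have hc1 : w c = 1 := (h2 (w c)).resolve_left hwc
  have h10 : (1 : ZMod (2 ^ 1)) ≠ 0 := by decide
  have h11 : (1 : ZMod (2 ^ 1)) + 1 = 0 := by decide
  intro x
  rw [hK, hK, hw, hc1]
  rcases h2 (w x) with h | h <;> rw [h]
  · rw [add_zero]; exact ⟨fun _ => h10, fun _ => rfl⟩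
  · rw [h11]; exact ⟨fun h' => absurd h' h10, fun h' => absurd rfl h'⟩

/-- **`d₂(G/𝒦) ≤ 1` for every central involution OUTSIDE the commutator subgroup** (finite `G`). [folklore] -/
theorem indexTwoRank_stabGen_le_one_of_notMem_commutator [Finite G] (hc2 : c * c = 1) (hcen : ∀ x : G, x * c = c * x)
    (hc : c ∉ commutator G) : indexTwoRank (stabGen c) ≤ 1 := by
  obtain ⟨k, hk, w, hw, h1, hwc⟩ := exists_cyclicCharacter_of_notMem_commutator hc2 hc
  by_cases hk1 : k = 1
  · subst hk1
    obtain ⟨K, hK⟩ := exists_ker hw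
    rw [indexTwoRank_stabGen_eq_zero_of_cpl c hc2 (isComplement_ker_of_level_one hw hwc hK)]
    exact zero_le_one
  · obtain ⟨E, hE⟩ := exists_even hw hk
    exact indexTwoRank_stabGen_le_one hE hw (by omega) h1 hc2 hcen hwc

/-- **`d₂(G/𝒦) ≥ 2 ⇒ c ∈ [G, G]`**: two independent «divided parities» force the involution into the commutator subgroup. [folklore] -/
theorem mem_commutator_of_two_le_indexTwoRank [Finite G] (hc2 : c * c = 1) (hcen : ∀ x : G, x * c = c * x)
    (h2 : 2 ≤ indexTwoRank (stabGen c)) : c ∈ commutator G := by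
  by_contra hc
  have h := indexTwoRank_stabGen_le_one_of_notMem_commutator hc2 hcen hc
  omega

/-! ## §3 In the fibre currency: `β − 2 ≤ φ₂ ≤ β` whenever `c ∉ [G, G]` -/

variable [Fintype G] [DecidableEq G]

/-- **`φ₂(G, c) ≤ β(G, c)` whenever `c ∉ [G, G]`** (`c ≠ 1` central involution). [folklore] -/
theorem fibreTwo_le_card_block_of_notMem_commutator (hc2 : c * c = 1) (hc1 : c ≠ 1) (hcen : ∀ x : G, x * c = c * x)
    (hc : c ∉ commutator G) : fibreTwo c hc2 ≤ Fintype.card (Block c) := by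
  have key := fibreTwo_add_eq_card_block_add_indexTwoRank c hc2 hc1 hcen
  have hd := indexTwoRank_stabGen_le_one_of_notMem_commutator hc2 hcen hc
  split_ifs at key <;> omega

/-- **`β(G, c) ≤ φ₂(G, c) + 2` whenever `c ∉ [G, G]`** (indeed always `β ≤ φ₂ + 1 + [|G|/2 even]`; recorded for the dichotomy). [folklore] -/
theorem card_block_le_fibreTwo_add_two_of_notMem_commutator (hc2 : c * c = 1) (hc1 : c ≠ 1) (hcen : ∀ x : G, x * c = c * x) :
    Fintype.card (Block c) ≤ fibreTwo c hc2 + 2 := by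
  have key := fibreTwo_add_eq_card_block_add_indexTwoRank c hc2 hc1 hcen
  split_ifs at key <;> omega

/-- **THE TRICHOTOMY in one line**: for a central involution `c ∉ [G, G]`, `φ₂(G, c) ∈ {β − 2, β − 1, β}`. [folklore] -/
theorem fibreTwo_mem_of_notMem_commutator (hc2 : c * c = 1) (hc1 : c ≠ 1) (hcen : ∀ x : G, x * c = c * x) (hc : c ∉ commutator G) :
    fibreTwo c hc2 + 2 = Fintype.card (Block c) ∨ fibreTwo c hc2 + 1 = Fintype.card (Block c) ∨ fibreTwo c hc2 = Fintype.card (Block c) := by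
  have h1 := fibreTwo_le_card_block_of_notMem_commutator hc2 hc1 hcen hc
  have h2 := card_block_le_fibreTwo_add_two_of_notMem_commutator hc2 hc1 hcen
  omega

end Commutator

end Summit.HodgeConjecture.CorCM.Census.CyclicCharacter
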